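import Summits.HodgeConjecture.HodgeConjecture.Theorems.F0P2pGR91NOfN3                               -- ★ U1 ⟸ N3 (`u1ThetaDichotomy_nonsplit_of_N3`), K1 chain cone
import Summits.HodgeConjecture.HodgeConjecture.Theorems.F0P2oLineWeilCMMultiplicityOne               -- ★ (1a) `finrank_coinvariants_xThetaGqsCM_le_one`
import Summits.HodgeConjecture.HodgeConjecture.Theorems.F0P3U3PrincipalSeriesJacquetFiltrationHolds  -- ★ N1 hypothesis-free
import Literature.NumberTheory.Automorphic.U3PrincipalSeriesJacquetFiltrationUnfold                   -- ★ N1 unfolded (`finrank = 2`)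
import Literature.NumberTheory.Automorphic.CMLocalRingModulusContinuous                               -- ★ `continuous_cmXiTorusChar_fst`
import HarnessLib

/-!
# Crux `H413`, row #106 (N4 ∕ T3b) road of B-p14 (g28) — THE LOCAL CORE: `i_G(χθ)` IS REDUCIBLE for the theta-type characters, from the N3 letter

Cell `hodgecm-mathlib` (D-0151), FLOOR 0, crux item H413 = `stmt-HodgeConjecture-24833`; THEOREMS ONLY (kernel lane,
`--supports stmt-HodgeConjecture-24833 --as helper`; no `def`, no instance, no notation, no named fact, no `sorry`).  Seat B-p10 (g22), offer (1b)
(cell bus 2026-08-31T21:12:57Z) under B-p14 (g28)'s #106 road (20:35:02Z) — B-p14 keeps the globalisation (GLOB ★ p834574 ∕ p834791), the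
reparametrisation and the #106 head `keysCaseTwoReducible_of_N3`.
HC_CM is proved only modulo the 2 remaining named inputs (hLiu418, h413) — behind them the booked printed statements + the MOD package — until rung 0
closes; nothing here discharges any of them (it derives the local core of #106 from the booked letter #96 N3).

WHAT IS PROVED.  `exists_subrepresentation_ne_bot_ne_top_of_N3 (hN3)`: for a CM field `L`, a conjugate-symplectic `μ`, a continuous unitary character
`χ_f` of `U(1)(𝔸_{L⁺,f})`, a place `v` of `L⁺` NON-SPLIT in `L`, and a character `ψθ` of `E¹_v` with the centre-character constraint
`IsThetaCenterChar L μ χf ε v ψθ` at every line `ε` (★ `exists_forall_isThetaCenterChar` produces such `ψθ`; B-p14's globalisation produces `(μ, χ_f)` with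
prescribed `(μ_v, ψθ)`), the principal series `i_G(χθ)` of `G = U(Φ₃)(L⁺_v)`, `χθ = cmXiTorusChar L v μ_v ψθ⁻¹ ψθ` (`d(α, β, ᾱ⁻¹) ↦ μ_v(α)‖α‖^{1/2}ψθ(β)`), has a
`G`-stable subspace `N ≠ 0, ≠ i_G(χθ)` — «`i_G(χθ)` is REDUCIBLE», the shape of ★ `Rogawski1990.KeysCaseTwoReducible`'s conclusion.
ROAD (GR91 §5: the Weil-representation realisation of `πⁿ(ξ_v)` has a one-dimensional Jacquet module).  Fix the identity frame `H = diag(1,1,1)`, `g = 1`,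
`e₁ = e₀ = prodUnique`, and a form congruence `ᵗT̄ H_v T = a·Φ₃` (★ `exists_formCongr_eq_smul_antidiag`).  (i) The class `⟦πG⟧` of Liu's local theta type
`X_v(μ, ε, χ_f)` read on `G` is a constituent of `i_G(χθ)`: ★ K1occ (`k1occ_of_u1ThetaDichotomy` under U1 ⟸ N3 ★ `u1ThetaDichotomy_nonsplit_of_N3`) gives a
line `ε` where `ψθ` occurs; ★ N3 ⟹ N3ᵟ (`thetaType_nonsplit_borelEigenfunctional_of_jacquetModule`) gives the non-zero `(B, χθʷδ^{1/2})`-eigenfunctional;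
★ K1c (`stubK1c_holds`) irreducibility ∕ smoothness; ★ K1b Frobenius (`isConstituentOf_mk_cmPrincipalSeries_xi_of_functional`) puts `⟦πG⟧` in `i_G(χθʷ)`;
★ K1w (`stubK1w_of_weylConj` over the hypothesis-free ★ `cmPrincipalSeries_isConstituentOf_weylConj_holds`) moves it to `i_G(χθ)`.  (ii) `dim r_N(πG) ≤ 1`:
`πG = xThetaGqsCM … (g_v⁻¹T)` on the nose (★ `localCongr_symm_localPiEquiv_symm_cmDatumLocalCongr`) and ★ (1a) `finrank_coinvariants_xThetaGqsCM_le_one hN3`.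
(iii) `dim r_N(i_G(χθ)) = 2`: ★ N1 `U3PrincipalSeriesJacquetFiltration_holds` (unfolded ★ `finiteDimensional_finrank_eq_two_of_U3PrincipalSeriesJacquetFiltration`) at
`χθ = cmTorusCharPair L v (ψθ⁻¹∘quotConj · μ_v · ‖·‖^{1/2}) ψθ` (★ `cmXiTorusChar_eq_cmTorusCharPair`, `rfl`).  (iv) If `i_G(χθ)` had no proper non-zero
subrepresentation it would be irreducible (`⊥ ≠ ⊤` since `r_N ≠ 0`), so ★ `IsConstituentOf.nonempty_equiv_of_isIrreducible` gives `πG ≃ i_G(χθ)`, whose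
Jacquet map is onto (★ `jacquetMap_surjective`): `2 = dim r_N(i_G(χθ)) ≤ dim r_N(πG) ≤ 1` — contradiction.

## References
* [GelbartRogawski1991] S. Gelbart, J. Rogawski, Invent. Math. 105 (1991): §3.2 (3.2.1)–(3.2.3) p. 457; §5.1 (5.1.1), Lem. 5.1.2 pp. 465–466; §5.2 p. 467.
* [Rogawski1990] J. Rogawski, Ann. of Math. Stud. 123 (1990): §12.1 p. 172; §12.2 (2) pp. 173–174.
* [Keys1984] D. Keys, Compositio Math. 51 (1984): §7 Theorem (2) p. 126.
* [Casselman1995] W. Casselman, unpublished notes (1995): Lemma 7.1.1 (a) p. 67; Thm. 6.3.5.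
* [BernsteinZelevinsky1977] I. N. Bernstein, A. V. Zelevinsky, Ann. Sci. ÉNS 10 (1977): §1.8, §2.12, Thm. 2.9.
* [MoeglinVignerasWaldspurger1987] LNM 1291 (1987): Chap. 3 §IV.4 Théorème principal 1) a).
-/

set_option autoImplicit false
-- the mandated namespace has the single-problem summit's repeated segment (`HodgeConjecture.HodgeConjecture`)
set_option linter.dupNamespace false

noncomputable section

open NumberField IsDedekindDomain MeasureTheory
open scoped Matrix Kronecker

open Literature.NumberTheory Literature.NumberTheory.Automorphic Literature.NumberTheory.Automorphic.UnitaryGroup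
open Literature.NumberTheory.Automorphic.IdeleClassGroup
open Literature.NumberTheory.Automorphic.Liu2021 Literature.NumberTheory.Automorphic.Liu2021.Def411WeilCarriers
open Literature.NumberTheory.GaloisRepresentations
open Literature.NumberTheory.Rogawski1990
open Literature.NumberTheory.GelbartRogawski1991
open Literature.RepresentationTheory

namespace Summit.HodgeConjecture.HodgeConjecture.Cruxes.H413.F0P2oCmPrincipalSeriesReducibleOfThetaType

/-! ## §1 Two generic lemmas -/

section Generic

universe u

variable {G : Type u} [Group G]

/-- A representation all of whose subrepresentations are `⊥` or `⊤`, on a space with `⊥ ≠ ⊤`, is irreducible (Mathlib: `IsIrreducible = IsSimpleOrder`).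
[cite: BushnellHenniart2006, §1.1] -/
theorem isIrreducible_of_forall_eq_bot_or_eq_top {V : Type*} [AddCommGroup V] [Module ℂ V] (ρ : Representation ℂ G V)
    (hnt : (⊥ : Subrepresentation ρ) ≠ ⊤) (h : ∀ N : Subrepresentation ρ, N = ⊥ ∨ N = ⊤) : ρ.IsIrreducible :=
  haveI : Nontrivial (Subrepresentation ρ) := ⟨⟨⊥, ⊤, hnt⟩⟩
  ⟨h⟩

/-- In a representation with `⊥ = ⊤` among its subrepresentations every Jacquet module is trivial. [folklore] -/
theorem subsingleton_coinvariants_of_bot_eq_top (t : ParabolicTriple G) {V : Type*} [AddCommGroup V] [Module ℂ V]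
    (ρ : Representation ℂ G V) (hbt : (⊥ : Subrepresentation ρ) = ⊤) : Subsingleton (t.restrict ρ).Coinvariants := by
  haveI : Subsingleton V :=
    (Submodule.subsingleton_iff ℂ).mp (subsingleton_of_bot_eq_top (congrArg Subrepresentation.toSubmodule hbt))
  exact (Representation.Coinvariants.mk_surjective _).subsingleton

/-- Along an EQUIVALENCE of representations the Jacquet module of the target has dimension at most that of the source, when the latter is
finite-dimensional (the Jacquet map of the equivalence is onto, ★ `jacquetMap_surjective`). [cite: BernsteinZelevinsky1977, §1.8] -/
theorem finrank_coinvariants_le_of_equiv (t : ParabolicTriple G) {V W : Type*} [AddCommGroup V] [Module ℂ V] [AddCommGroup W] [Module ℂ W]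
    {ρ : Representation ℂ G V} {σ : Representation ℂ G W} (e : ρ.Equiv σ) [FiniteDimensional ℂ (t.restrict ρ).Coinvariants] :
    Module.finrank ℂ (t.restrict σ).Coinvariants ≤ Module.finrank ℂ (t.restrict ρ).Coinvariants := by
  have hs : Function.Surjective (Representation.jacquetMap t e.toIntertwiningMap).toLinearMap :=
    Representation.jacquetMap_surjective t e.toIntertwiningMap e.toLinearEquiv.surjective
  rw [← LinearMap.range_eq_top] at hs
  rw [← finrank_top ℂ (t.restrict σ).Coinvariants, ← hs]
  exact LinearMap.finrank_range_le _

end Generic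

/-! ## §2 The local core of #106: `i_G(χθ)` is reducible, from N3 -/

section CM

open Literature.RepresentationTheory.Liu2021

set_option synthInstance.maxHeartbeats 400000 in
set_option maxHeartbeats 16000000 in -- MEASURED (as ★ `F0P2oThetaInPSOfLetters`): the K1-chain carriers (`xThetaCM ∘ κ_v⁻¹ ∘ congr_T`) are heavy to elaborate
/-- **THE LOCAL CORE OF #106 FROM N3: `i_G(χθ)` IS REDUCIBLE.**  Under the N3 letter ★ `GelbartRogawski1991.thetaType_nonsplit_jacquetModule` (`hN3`): for a
conjugate-symplectic `μ`, a continuous unitary `χ_f`, a NON-SPLIT `v` and a character `ψθ` of `E¹_v` with `IsThetaCenterChar L μ χf ε v ψθ` at every line `ε`,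
the principal series `cmPrincipalSeries L 3 v (cmXiTorusChar L v μ_v ψθ⁻¹ ψθ)` of `U(Φ₃)(L⁺_v)` has a subrepresentation `N` with `N ≠ ⊥` and `N ≠ ⊤`.
(Road: the class of Liu's local theta type `X_v(μ, ε, χ_f)` is a constituent of `i_G(χθ)` with `dim r_N ≤ 1` (N3 + MVW multiplicity one), while
`dim r_N(i_G(χθ)) = 2` (N1); an irreducible `i_G(χθ)` would be `≃ X_v`.)
[cite: GelbartRogawski1991, §5.1 (5.1.1) p. 465, Lem. 5.1.2 pp. 465–466; §3.2 (3.2.1)–(3.2.2) p. 457] [cite: Rogawski1990, §12.2 (2) pp. 173–174]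
[cite: Keys1984, §7 Theorem (2) p. 126] [cite: Casselman1995, Lemma 7.1.1 (a) p. 67] -/
theorem exists_subrepresentation_ne_bot_ne_top_of_N3
    (hN3 : Literature.NumberTheory.GelbartRogawski1991.thetaType_nonsplit_jacquetModule)
    (L : Type) [Field L] [NumberField L] [IsCMField L]
    (μ : Literature.NumberTheory.Automorphic.IdeleClassGroup L →ₜ* Circle) (hμ : IsConjugateSymplectic L μ)
    (χf : UnitaryGroup.finAdelicOne (↥(maximalRealSubfield L)) L (IsCMField.complexConj L) →* ℂˣ)
    (hχc : Continuous χf) (hχu : ∀ z, ‖((χf z : ℂˣ) : ℂ)‖ = 1)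
    (v : HeightOneSpectrum (𝓞 ↥(maximalRealSubfield L)))
    (hv : ∀ w : PlacesOver L v, IsCMField.complexConj L • w.1 = w.1)
    (ψθ : ↥(normOneUnits (conjLocal L (IsCMField.complexConj L) v)) →* ℂˣ)
    (hψ : ∀ ε : (↥(maximalRealSubfield L))ˣ, IsThetaCenterChar L μ χf ε v ψθ) :
    ∃ N : Subrepresentation (cmPrincipalSeries L 3 v
        (cmXiTorusChar L v ((toHeckeCharacter L μ).semilocalComponent L v) ψθ⁻¹ ψθ)), N ≠ ⊥ ∧ N ≠ ⊤ := by
  haveI := locallyCompactSpace_cmBorelU L 3 v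
  -- the identity frame `H = diag(1,1,1)`, `g = 1`, and a form congruence `ᵗT̄ H_v T = a·Φ₃` at the non-split `v`
  have hdV : ∀ i : Fin 3, IsCMField.complexConj L ((fun _ : Fin 3 => (1 : L)) i) = (fun _ : Fin 3 => (1 : L)) i := fun _ => map_one _
  have hdV0 : ∀ i : Fin 3, (fun _ : Fin 3 => (1 : L)) i ≠ 0 := fun _ => one_ne_zero
  have hH := F0P2oU1DisjointOfTower.diagonal_isHermitian (L := L) (fun _ : Fin 3 => (1 : L)) hdV
  have hHd := F0P2oU1DisjointOfTower.isUnit_det_diagonal (L := L) (fun _ : Fin 3 => (1 : L)) hdV0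
  have hg := F0P2oU1DisjointOfTower.one_frame (L := L) (fun _ : Fin 3 => (1 : L))
  obtain ⟨T, a, ha, h⟩ := exists_formCongr_eq_smul_antidiag (L := L) hH hHd v hv
  -- (i) K1occ: a line `ε` where `ψθ` occurs (U1 ⟸ N3)
  obtain ⟨ε, hocc⟩ := F0P2oK1occ.k1occ_of_u1ThetaDichotomy (F0P2pGR91NOfN3.u1ThetaDichotomy_nonsplit_of_N3 hN3) L
    (Equiv.prodUnique (Fin 1) (Fin 1)) (fun _ : Fin 3 => (1 : L)) hdV hdV0 μ hμ χf hχc v hv 1 ψθ (hψ 1)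
  -- K1aʷ: the non-zero Borel eigenfunctional on `πG` (N3 ⟹ N3ᵟ)
  obtain ⟨ℓ, hℓ0, hℓ⟩ := F0P2oBorelEigenfunctionalOfJacquetModule.thetaType_nonsplit_borelEigenfunctional_of_jacquetModule hN3 L
    (Matrix.diagonal fun _ : Fin 3 => (1 : L)) hH hHd (Equiv.prodUnique (Fin 3) (Fin 1)) (fun _ : Fin 3 => (1 : L)) hdV hdV0 1 hg
    (Equiv.prodUnique (Fin 1) (Fin 1)) μ hμ χf hχc hχu v hv T a ha h ε ψθ (hψ ε) hocc
  -- K1c: `πG` is irreducible and smooth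
  obtain ⟨hirr, hsm, -⟩ := F0P2oXThetaOwnClass.stubK1c_holds L (Matrix.diagonal fun _ : Fin 3 => (1 : L)) hH hHd
    (Equiv.prodUnique (Fin 3) (Fin 1)) (fun _ : Fin 3 => (1 : L)) hdV hdV0 1 hg μ hμ χf hχc hχu v hv T a ha h ε
  -- K1b + K1w: `⟦πG⟧` is a constituent of `i_G(χθ)`
  have hc := F0P2oK1wOfWeylConj.stubK1w_of_weylConj F0P2pK1wHolds.cmPrincipalSeries_isConstituentOf_weylConj_holds L
    (Matrix.diagonal fun _ : Fin 3 => (1 : L)) hH hHd (Equiv.prodUnique (Fin 3) (Fin 1)) (fun _ : Fin 3 => (1 : L)) hdV hdV0 1 hg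
    μ hμ χf hχc hχu v hv T a ha h ψθ _
    (F0P2nFrobeniusFunctional.isConstituentOf_mk_cmPrincipalSeries_xi_of_functional L v _ ψθ⁻¹ ψθ _ hirr hsm ℓ hℓ hℓ0)
  -- (ii) `dim r_N(πG) ≤ 1`: `πG = X_v read along congr_{g_v⁻¹ T}` on the nose, then (1a)
  have h' := F0P2oBorelEigenfunctionalOfJacquetModule.formCongr_inv_toLocalGL_mul_eq L hg v T h
  have hπ : (((xThetaCM L (Equiv.prodUnique (Fin 3) (Fin 1)) (fun _ : Fin 3 => (1 : L)) hdV hdV0 μ hμ χf ε v :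
        localPi L (IsCMField.complexConj L) 3 (Matrix.diagonal fun _ : Fin 3 => (1 : L)) v →* _).comp
        (localCongr L (IsCMField.complexConj L) (1 : GL (Fin 3) L) one_ne_zero (by rw [one_smul]; exact hg) v).symm.toMulEquiv.toMonoidHom).comp
        ((cmDatumLocalCongr L v T ha h).trans
          (localPiEquiv L (IsCMField.complexConj L) 3 (Matrix.diagonal fun _ : Fin 3 => (1 : L)) v).symm).toMulEquiv.toMonoidHom) =
      xThetaGqsCM L (Equiv.prodUnique (Fin 3) (Fin 1)) (fun _ : Fin 3 => (1 : L)) hdV hdV0 μ hμ χf ε v ((toLocalGL L v 1)⁻¹ * T) ha h' :=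
    MonoidHom.ext fun u => congrArg (xThetaCM L (Equiv.prodUnique (Fin 3) (Fin 1)) (fun _ : Fin 3 => (1 : L)) hdV hdV0 μ hμ χf ε v :
        localPi L (IsCMField.complexConj L) 3 (Matrix.diagonal fun _ : Fin 3 => (1 : L)) v →* _)
      (F0P2oBorelEigenfunctionalOfJacquetModule.localCongr_symm_localPiEquiv_symm_cmDatumLocalCongr L hg v T ha h u)
  obtain ⟨hfd, hle1⟩ := @Eq.subst _ (fun ρ => FiniteDimensional ℂ ((cmBorelTriple L 3 v).restrict ρ).Coinvariants ∧
      Module.finrank ℂ ((cmBorelTriple L 3 v).restrict ρ).Coinvariants ≤ 1) _ _ hπ.symm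
    (F0P2oLineWeilCMMultiplicityOne.finrank_coinvariants_xThetaGqsCM_le_one hN3 L (Equiv.prodUnique (Fin 3) (Fin 1))
      (fun _ : Fin 3 => (1 : L)) hdV hdV0 (Equiv.prodUnique (Fin 1) (Fin 1)) μ hμ χf hχc hχu v hv ε ψθ (hψ ε) ((toLocalGL L v 1)⁻¹ * T) a ha h')
  -- (iii) `dim r_N(i_G(χθ)) = 2` (N1, hypothesis-free)
  have hψc : Continuous fun β => ((ψθ β : ℂˣ) : ℂ) := F0P2oK1occ.continuous_of_isThetaCenterChar L μ χf hχc 1 v ψθ (hψ 1)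
  have hψic : Continuous fun β => ((ψθ⁻¹ β : ℂˣ) : ℂ) := by
    simp only [MonoidHom.inv_apply, Units.val_inv_eq_inv_val]
    exact hψc.inv₀ fun β => Units.ne_zero _
  have hμc : Continuous fun x => (((toHeckeCharacter L μ).semilocalComponent L v x : ℂˣ) : ℂ) :=
    Units.continuous_val.comp (continuous_semilocalComponent L (toHeckeCharacter L μ))
  obtain ⟨-, h2⟩ :
      FiniteDimensional ℂ ((cmBorelTriple L 3 v).restrict (cmPrincipalSeries L 3 v
          (cmXiTorusChar L v ((toHeckeCharacter L μ).semilocalComponent L v) ψθ⁻¹ ψθ))).Coinvariants ∧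
        Module.finrank ℂ ((cmBorelTriple L 3 v).restrict (cmPrincipalSeries L 3 v
          (cmXiTorusChar L v ((toHeckeCharacter L μ).semilocalComponent L v) ψθ⁻¹ ψθ))).Coinvariants = 2 :=
    finiteDimensional_finrank_eq_two_of_U3PrincipalSeriesJacquetFiltration L
      (F0P3U3PrincipalSeriesJacquetFiltrationHolds.U3PrincipalSeriesJacquetFiltration_holds L) v hv
      ((ψθ⁻¹).comp (quotConj (conjLocal L (IsCMField.complexConj L) v) (conjLocal_conjLocal_cm L v)) *
        (toHeckeCharacter L μ).semilocalComponent L v * halfModulusChar (LocalRing L v)) ψθ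
      (continuous_cmXiTorusChar_fst L v _ ψθ⁻¹ hμc hψic) hψc
  -- (iv) an irreducible `i_G(χθ)` would be `≃ πG`: `2 ≤ 1`
  by_contra hne
  push Not at hne
  have hnt : (⊥ : Subrepresentation (cmPrincipalSeries L 3 v
      (cmXiTorusChar L v ((toHeckeCharacter L μ).semilocalComponent L v) ψθ⁻¹ ψθ))) ≠ ⊤ := by
    intro hbt
    -- `⊥ = ⊤` forces the space, hence its Jacquet module, to be trivial: `finrank = 0 ≠ 2`
    haveI := subsingleton_coinvariants_of_bot_eq_top (cmBorelTriple L 3 v) _ hbt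
    have h0 := h2
    rw [Module.finrank_zero_of_subsingleton] at h0
    exact absurd h0 (by norm_num)
  have hirrPS := isIrreducible_of_forall_eq_bot_or_eq_top _ hnt fun N => (eq_or_ne N ⊥).imp_right (hne N)
  obtain ⟨e⟩ := @IrrClass.IsConstituentOf.nonempty_equiv_of_isIrreducible _ _ _ _ _ _ _ hirrPS _ hc
  haveI := hfd
  have hle2 := finrank_coinvariants_le_of_equiv (cmBorelTriple L 3 v) e
  have h21 : (2 : ℕ) ≤ 1 := h2 ▸ hle2.trans hle1
  omega

end CM

end Summit.HodgeConjecture.HodgeConjecture.Cruxes.H413.F0P2oCmPrincipalSeriesReducibleOfThetaType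

end
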